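import Literature.MathematicalPhysics.QuantumLattice.GrassmannMonomialDeletion
import Mathlib.Analysis.RCLike.Basic
import HarnessLib

/-!
# The deletion expansion: derivatives and Laplacians applied to a monomial, read through a Gram-bounded
# functional

Topic `Literature/MathematicalPhysics/QuantumLattice`; the combinatorial core of the single-scale tree
estimate in the Laplacian host.  A product of field DERIVATIVES `∂_X` (kernel extraction) and LAPLACIANS
`Δ_{C'}` (tree lines) applied to a monomial `ψ(Z₀)⋯ψ(Z_{N-1})` is, by the deletion formulas of
`GrassmannMonomialDeletion.lean`, a signed sum of sub-monomials `∏_{i ∈ S} ψ(Z_i)` indexed by **deletion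
patterns** — which position each derivative deletes, which ordered pair of positions each Laplacian deletes —
with coefficients `δ_{Z_p, X}` resp. `½ C'(Z_q, Z_p)`.  The pattern sets do NOT depend on the labels `Z`
(only the weights do), which is what allows the later exchange with the sum over the labels.  If a linear
functional `L` (a Gaussian expectation) obeys the Gram bound `‖L(∏_{i∈S} ψ(Z_i))‖ ≤ κ^{|S|}` on all
sub-monomials, then (**`norm_apply_applyOps_genProdOn_le`**)

`‖L (∏ ops · ∏_S ψ(Z))‖ ≤ Σ_{patterns π of ops on S} weight(Z, π) · κ^{|S| − #deleted}`,
`weight = ∏_{derivatives} δ_{Z_p, X} · ∏_{Laplacians} ½ ‖C'(Z_q, Z_p)‖`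

(Benfatto–Giuliani–Mastropietro 2006, proof of (2.77): the sum over the choices of the fields of the tree
lines with the propagators as weights, the remaining determinant bounded by Gram–Hadamard; Feldman–Knörrer–
Trubowitz 2004, §II: contraction and integral bounds).  Definitions: `DelOp` (an operation), `DelOp.toEnd`,
`stepSet`, `rest`, `coef`, `weight`, `applyOps`, `patSet` (lists of steps), `patWeight`, `totalCost`.
Everything is proved; no named fact.

## Sources

G. Benfatto, A. Giuliani, V. Mastropietro, Ann. Henri Poincaré 7 (2006) 809–898, proof of (2.77)
(`BenfattoGiulianiMastropietro2006`); J. Feldman, H. Knörrer, E. Trubowitz, Commun. Math. Phys. 247 (2004)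
195–242, §II (`FeldmanKnorrerTrubowitz2004`).
-/

noncomputable section

namespace Literature.MathematicalPhysics.QuantumLattice

open GrassmannAlgebra Finset

/-! ### Deletion operations and one deletion step -/

/-- A **deletion operation** on monomials: a field derivative `∂_X` (deletes one field) or a Laplacian
`Δ_{C'}` (deletes an ordered pair of fields). [folklore] -/
inductive DelOp (Γ : Type*) (𝕜 : Type*)
  /-- the derivative `∂_X` -/
  | ext (X : Γ) : DelOp Γ 𝕜
  /-- the Laplacian `Δ_{C'}` -/
  | lap (C' : Matrix Γ Γ 𝕜) : DelOp Γ 𝕜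

namespace DelOp

variable {𝕜 : Type*} [RCLike 𝕜] {Γ : Type*} [Fintype Γ] [DecidableEq Γ] {N : ℕ}

/-- The operator of a deletion operation. [folklore] -/
def toEnd : DelOp Γ 𝕜 → Module.End 𝕜 (GrassmannAlgebra 𝕜 Γ)
  | ext X => grassmannDeriv 𝕜 X
  | lap C' => grassmannLaplacian 𝕜 C'

/-- The number of fields deleted. [folklore] -/
def cost : DelOp Γ 𝕜 → ℕ
  | ext _ => 1
  | lap _ => 2

/-- The **steps** of an operation on the position set `S`: the deleted position `(p, p)` of a derivative,
the ordered pair `(p, q)`, `q ≠ p`, of a Laplacian (first `p`, then `q`). [folklore] -/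
def stepSet (S : Finset (Fin N)) : DelOp Γ 𝕜 → Finset (Fin N × Fin N)
  | ext _ => (S ×ˢ S).filter fun pq => pq.2 = pq.1
  | lap _ => (S ×ˢ S).filter fun pq => pq.2 ≠ pq.1

/-- The positions remaining after a step. [folklore] -/
def rest (S : Finset (Fin N)) : DelOp Γ 𝕜 → Fin N × Fin N → Finset (Fin N)
  | ext _, pq => S.erase pq.1
  | lap _, pq => (S.erase pq.1).erase pq.2

/-- The exact **coefficient** of a step (with its sign). [folklore] -/
def coef (Z : Fin N → Γ) (S : Finset (Fin N)) : DelOp Γ 𝕜 → Fin N × Fin N → 𝕜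
  | ext X, pq => if Z pq.1 = X then (-1 : 𝕜) ^ (S.filter (· < pq.1)).card else 0
  | lap C', pq => ((1 / 2 : ℚ) • (1 : 𝕜)) * (C' (Z pq.2) (Z pq.1) *
      (-1 : 𝕜) ^ ((S.filter (· < pq.1)).card + ((S.erase pq.1).filter (· < pq.2)).card))

/-- The **weight** of a step: `δ_{Z_p, X}` for a derivative, `½ ‖C'(Z_q, Z_p)‖` for a Laplacian. [folklore] -/
def weight (Z : Fin N → Γ) : DelOp Γ 𝕜 → Fin N × Fin N → ℝ
  | ext X, pq => if Z pq.1 = X then 1 else 0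
  | lap C', pq => 1 / 2 * ‖C' (Z pq.2) (Z pq.1)‖

omit [RCLike 𝕜] [Fintype Γ] [DecidableEq Γ] in
/-- Sums over the steps of a derivative. [folklore] -/
theorem sum_stepSet_ext {M : Type*} [AddCommMonoid M] (S : Finset (Fin N)) (X : Γ) (f : Fin N × Fin N → M) :
    ∑ pq ∈ stepSet S (ext X : DelOp Γ 𝕜), f pq = ∑ p ∈ S, f (p, p) := by
  rw [stepSet, sum_finset_product _ S (fun p => {p}) (fun pq => ?_)]
  · exact sum_congr rfl fun p _ => sum_singleton _ _
  · rw [mem_filter, mem_product, mem_singleton]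
    constructor
    · rintro ⟨⟨h1, -⟩, h3⟩; exact ⟨h1, h3⟩
    · rintro ⟨h1, h3⟩; exact ⟨⟨h1, h3 ▸ h1⟩, h3⟩

omit [RCLike 𝕜] [Fintype Γ] [DecidableEq Γ] in
/-- Sums over the steps of a Laplacian. [folklore] -/
theorem sum_stepSet_lap {M : Type*} [AddCommMonoid M] (S : Finset (Fin N)) (C' : Matrix Γ Γ 𝕜) (f : Fin N × Fin N → M) :
    ∑ pq ∈ stepSet S (lap C' : DelOp Γ 𝕜), f pq = ∑ p ∈ S, ∑ q ∈ S.erase p, f (p, q) := by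
  rw [stepSet, sum_finset_product _ S (fun p => S.erase p) (fun pq => ?_)]
  rw [mem_filter, mem_product, mem_erase]
  tauto

omit [RCLike 𝕜] [Fintype Γ] [DecidableEq Γ] in
/-- The number of remaining positions after a valid step. [folklore] -/
theorem card_rest {S : Finset (Fin N)} : ∀ (o : DelOp Γ 𝕜) {pq : Fin N × Fin N}, pq ∈ stepSet S o →
    (rest S o pq).card = S.card - cost o
  | ext X, pq, h => by
    obtain ⟨hpq, -⟩ := mem_filter.1 h
    rw [rest, cost, card_erase_of_mem (mem_product.1 hpq).1]
  | lap C', pq, h => by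
    obtain ⟨hpq, hne⟩ := mem_filter.1 h
    obtain ⟨hp, hq⟩ := mem_product.1 hpq
    rw [rest, cost, card_erase_of_mem (mem_erase.2 ⟨hne, hq⟩), card_erase_of_mem hp, Nat.sub_sub]

/-- **One deletion step, exactly**: the operator applied to a sub-monomial is the sum over its steps of
coefficient times the remaining sub-monomial. [folklore] -/
theorem toEnd_genProdOn (Z : Fin N → Γ) (S : Finset (Fin N)) : ∀ o : DelOp Γ 𝕜,
    o.toEnd (genProdOn 𝕜 Z S) = ∑ pq ∈ stepSet S o, coef Z S o pq • genProdOn 𝕜 Z (rest S o pq)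
  | ext X => by
    rw [toEnd, sum_stepSet_ext, grassmannDeriv_genProdOn]
    refine sum_congr rfl fun p _ => ?_
    simp only [coef, rest, ite_smul, zero_smul]
  | lap C' => by
    rw [toEnd, sum_stepSet_lap, grassmannLaplacian_genProdOn, smul_sum]
    refine sum_congr rfl fun p _ => ?_
    rw [smul_sum]
    refine sum_congr rfl fun q _ => ?_
    simp only [coef, rest, smul_smul]

omit [Fintype Γ] in
/-- The coefficient of a step is bounded by its weight. [folklore] -/
theorem norm_coef_le (Z : Fin N → Γ) (S : Finset (Fin N)) : ∀ (o : DelOp Γ 𝕜) (pq : Fin N × Fin N),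
    ‖coef Z S o pq‖ ≤ weight Z o pq
  | ext X, pq => by
    simp only [coef, weight]
    split_ifs
    · rw [norm_pow, norm_neg, norm_one, one_pow]
    · rw [norm_zero]
  | lap C', pq => by
    rw [coef, weight, norm_mul, norm_mul, norm_pow, norm_neg, norm_one, one_pow, mul_one, Rat.smul_one_eq_cast]
    refine le_of_eq ?_
    congr 1
    rw [Rat.cast_div, Rat.cast_one, Rat.cast_ofNat, norm_div, norm_one, RCLike.norm_ofNat]

omit [Fintype Γ] in
/-- Weights are nonnegative. [folklore] -/
theorem weight_nonneg (Z : Fin N → Γ) : ∀ (o : DelOp Γ 𝕜) (pq : Fin N × Fin N), 0 ≤ weight Z o pq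
  | ext X, pq => by simp only [weight]; split_ifs <;> norm_num
  | lap C', pq => by simp only [weight]; positivity

end DelOp

/-! ### Lists of operations and deletion patterns -/

section Patterns

variable {𝕜 : Type*} [RCLike 𝕜] {Γ : Type*} [Fintype Γ] [DecidableEq Γ] {N : ℕ}

/-- The product of a list of operations, the HEAD applied FIRST. [folklore] -/
def applyOps : List (DelOp Γ 𝕜) → Module.End 𝕜 (GrassmannAlgebra 𝕜 Γ)
  | [] => 1
  | o :: ops => applyOps ops * o.toEnd

omit [DecidableEq Γ] in
/-- `iterDeriv` is the product of the derivatives of its labels, first label first. [folklore] -/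
theorem applyOps_map_ext {r : ℕ} (W : Fin r → Γ) :
    applyOps ((List.ofFn W).map (DelOp.ext (𝕜 := 𝕜))) = iterDeriv 𝕜 W := by
  rw [iterDeriv]
  induction r with
  | zero => simp [applyOps]
  | succ r ih =>
    rw [List.ofFn_succ, List.map_cons, applyOps, ih (fun i => W i.succ), List.ofFn_succ, List.reverse_cons,
      List.prod_append, List.prod_singleton]
    rfl

omit [DecidableEq Γ] in
/-- Appending lists composes the operators (the first list applied first). [folklore] -/
theorem applyOps_append : ∀ ops ops' : List (DelOp Γ 𝕜), applyOps (ops ++ ops') = applyOps ops' * applyOps ops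
  | [], ops' => by rw [List.nil_append, applyOps, mul_one]
  | o :: ops, ops' => by rw [List.cons_append, applyOps, applyOps, applyOps_append ops ops', mul_assoc]

/-- The total number of deleted fields. [folklore] -/
def totalCost (ops : List (DelOp Γ 𝕜)) : ℕ := (ops.map DelOp.cost).sum

/-- Prepending a step to a pattern (an embedding). [folklore] -/
def consEmb (N : ℕ) : (_ : Fin N × Fin N) × List (Fin N × Fin N) ↪ List (Fin N × Fin N) :=
  ⟨fun x => x.1 :: x.2, fun x y h => by
    obtain ⟨h1, h2⟩ := List.cons_eq_cons.1 h
    exact Sigma.ext h1 (heq_of_eq h2)⟩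

/-- The **patterns** of a list of operations on the position set `S` (lists of steps: a step of the head on
`S`, then a pattern of the tail on the remaining positions).  Independent of the labels. [folklore] -/
def patSet : List (DelOp Γ 𝕜) → Finset (Fin N) → Finset (List (Fin N × Fin N))
  | [], _ => {[]}
  | o :: ops, S => ((DelOp.stepSet S o).sigma fun pq => patSet ops (DelOp.rest S o pq)).map (consEmb N)

/-- The **weight** of a pattern: the product of the weights of its steps. [folklore] -/
def patWeight (Z : Fin N → Γ) : List (DelOp Γ 𝕜) → List (Fin N × Fin N) → ℝ
  | [], _ => 1
  | _ :: _, [] => 0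
  | o :: ops, pq :: π => DelOp.weight Z o pq * patWeight Z ops π

omit [Fintype Γ] in
/-- The weight of a pattern with a first step. [folklore] -/
theorem patWeight_cons (Z : Fin N → Γ) (o : DelOp Γ 𝕜) (ops : List (DelOp Γ 𝕜)) (pq : Fin N × Fin N)
    (π : List (Fin N × Fin N)) : patWeight Z (o :: ops) (pq :: π) = DelOp.weight Z o pq * patWeight Z ops π := rfl

omit [Fintype Γ] in
/-- Pattern weights are nonnegative. [folklore] -/
theorem patWeight_nonneg (Z : Fin N → Γ) : ∀ (ops : List (DelOp Γ 𝕜)) (π : List (Fin N × Fin N)), 0 ≤ patWeight Z ops π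
  | [], _ => zero_le_one
  | _ :: _, [] => le_rfl
  | o :: ops, pq :: π => mul_nonneg (DelOp.weight_nonneg Z o pq) (patWeight_nonneg Z ops π)

omit [RCLike 𝕜] [Fintype Γ] [DecidableEq Γ] in
/-- Sums over the patterns of `o :: ops` are iterated sums: first the step, then the patterns of the rest.
[folklore] -/
theorem sum_patSet_cons {M : Type*} [AddCommMonoid M] (o : DelOp Γ 𝕜) (ops : List (DelOp Γ 𝕜)) (S : Finset (Fin N))
    (f : List (Fin N × Fin N) → M) :
    ∑ π ∈ patSet (o :: ops) S, f π = ∑ pq ∈ DelOp.stepSet S o, ∑ π ∈ patSet ops (DelOp.rest S o pq), f (pq :: π) := by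
  rw [patSet, sum_map, sum_sigma]
  rfl

/-- **The deletion expansion read through a Gram-bounded functional** (Benfatto–Giuliani–Mastropietro
2006, proof of (2.77)): if `‖L (∏_{i∈S} ψ(Z_i))‖ ≤ κ^{|S|}` for all `S`, then for every list of derivatives and
Laplacians
`‖L (∏ ops ∏_S ψ(Z))‖ ≤ Σ_{patterns π on S} weight(Z, π) κ^{|S| − #deleted}`. [cite: BenfattoGiulianiMastropietro2006, proof of (2.77)] -/
theorem norm_apply_applyOps_genProdOn_le (L : GrassmannAlgebra 𝕜 Γ →ₗ[𝕜] 𝕜) (Z : Fin N → Γ) {κ : ℝ} (hκ : 0 ≤ κ)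
    (hL : ∀ S : Finset (Fin N), ‖L (genProdOn 𝕜 Z S)‖ ≤ κ ^ S.card) :
    ∀ (ops : List (DelOp Γ 𝕜)) (S : Finset (Fin N)),
      ‖L (applyOps ops (genProdOn 𝕜 Z S))‖ ≤ ∑ π ∈ patSet ops S, patWeight Z ops π * κ ^ (S.card - totalCost ops)
  | [], S => by
    rw [applyOps, Module.End.one_apply, patSet, sum_singleton, patWeight, one_mul, totalCost, List.map_nil, List.sum_nil,
      Nat.sub_zero]
    exact hL S
  | o :: ops, S => by
    rw [applyOps, Module.End.mul_apply, DelOp.toEnd_genProdOn, map_sum, map_sum, sum_patSet_cons]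
    refine (norm_sum_le _ _).trans (sum_le_sum fun pq hpq => ?_)
    rw [map_smul, map_smul, smul_eq_mul, norm_mul]
    have ih := norm_apply_applyOps_genProdOn_le L Z hκ hL ops (DelOp.rest S o pq)
    rw [DelOp.card_rest o hpq, Nat.sub_sub] at ih
    have hcost : totalCost (o :: ops) = o.cost + totalCost ops := by rw [totalCost, totalCost, List.map_cons, List.sum_cons]
    rw [hcost]
    calc ‖DelOp.coef Z S o pq‖ * ‖L (applyOps ops (genProdOn 𝕜 Z (DelOp.rest S o pq)))‖
        ≤ DelOp.weight Z o pq * ∑ π ∈ patSet ops (DelOp.rest S o pq), patWeight Z ops π * κ ^ (S.card - (o.cost + totalCost ops)) :=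
          mul_le_mul (DelOp.norm_coef_le Z S o pq) ih (norm_nonneg _) (DelOp.weight_nonneg Z o pq)
      _ = ∑ π ∈ patSet ops (DelOp.rest S o pq), patWeight Z (o :: ops) (pq :: π) * κ ^ (S.card - (o.cost + totalCost ops)) := by
          rw [mul_sum]
          exact sum_congr rfl fun π _ => by rw [patWeight_cons, mul_assoc]

end Patterns

end Literature.MathematicalPhysics.QuantumLattice
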